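import Summits.BirchSwinnertonDyer.BirchSwinnertonDyer.Theorems.KimAtThreeD7uTamagawaKuriharaDeepLe
import Summits.BirchSwinnertonDyer.BirchSwinnertonDyer.Theorems.KimAtThreeD7uTamagawaKuriharaWitness
import Summits.BirchSwinnertonDyer.Rank1Residual.GaloisImage.KolyvaginPrimeOfFrobeniusClassDeep
import Summits.BirchSwinnertonDyer.Rank1Residual.GaloisImage.PropagatedConditionTopOfNoTorsionThree
import Literature.NumberTheory.EllipticCurves.NonEisensteinPrimeOfSurjective
import HarnessLib

/-!
# The TAMAGAWA-DIVISIBLE bad places, XXV: «TamDiv∞» in KURIHARA currency — the END: the deep bound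
# `3^{m+1} ∣ c_ℓ ⇒ (m + 1 : ℕ∞) ≤ ∂^{(∞)}_{deep}(δ̃)` FROM KATO'S EULER SYSTEM (`ZetaBody`), the (P-EXP)
# riders and the value rows — ★ PK-6₂'s displayed inputs — plus part XV's binders; NO `hbad`, NO new port
# (cell `bsd-addord`, seat w2-tamdiv gen 7; route W2 `KimAtThreeKolyvagin`, items 19679 / 19562 / 19599 (TD),
# 19560)

HONEST FRAMING: an END THEOREM WITH DISPLAYED HYPOTHESES (no definition, no named fact, no `sorry`);
closes NO row by itself; nothing is booked; BSD is not proved by any of this.  Displayed, nothing hidden: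
(a) Kato's cited fact's matrix `ZetaBody W 3 P₀.f ι κK Λ c d a A z x` on witnesses bound for `P₀.f` at the
conductor level `hN` (the NAMED FACT `Kato2004.exists_eulerSystem_expStar_values` supplies them when `W[3]`
is irreducible — not instantiated here: ROUTE-1 §48.4 socket), (b) the CONSTRUCTION-SHAPED (P-EXP) riders
`KatoExpStarFiniteLevelAt W 3 j 0 v₃ Λ (Λfin j)` at every depth (cell n1011 PK-5; never `_holds`),
(c) `ht0` (no `3`-torsion over `ℚ₃`: `t = 0`) and `hcdA` (no prime `≡ 1 (mod 3)` divides `2cdA`),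
(d) the per-level VALUE ROWS `hvalue` (n1011 T-PK6-VROW's OUT) — (a)–(d) VERBATIM the displayed inputs of
n1011-p13's ★ PK-6₂ `katoKuriharaPortThreeAtWith₂_zero_of_zetaBody` (p328933) MINUS THEOREM D's `hbad` —,
(e) part XV's binders (Poitou–Tate family `inv` at `3`, Tate's `hEP`, `T ⊇ {3} ∪ bad`, no `Γ_ℚ`-fixed
points, ONE `τ` with (H.2)-cokernels at every level fixing `μ_{3^{m+1}}`, data `D j` on Sakamoto's class
of `τ` through `E[3^m·3]` off EXACTLY `{bad} ∪ {3}`, canonical and admissible for `j ≤ m` (the bounded,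
satisfiable form of part XXIII-le / XV-le) with ONE `η`, the level-one prime choice `hprime`), (f) the `3`-adic tower, and (g) **`3^{m+1} ∣ c_ℓ` at ONE finite `ℓ ∤ 3`** (any
reduction type).  Concluded: **`(m + 1 : ℕ∞) ≤ kuriharaPartialDeepInfty W 3 P₀.f`** — every Kurihara
number of the newform at every cyclic level `n ∈ 𝒩_{m+1}(E,3)` is divisible by `3^{m+1}`.

## How

Part XXIII-le `natCast_le_kuriharaPartialDeepInfty_of_witnesses_of_pow_succ_dvd_le` with its displayed
`𝓕_u`-witness at depth `k ≤ m` supplied by part XXIV `exists_katoKuriharaWitnessAt_blochKato_of_zetaBody`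
on the datum `D k`; the three side inputs of the latter exactly as in ★ PK-6₂: the class primes are
Kolyvagin of level `k + 1` (n1011-p13 E1-deep
`KolyvaginPrime.isKolyvaginPrime_of_mem_frobeniusClassPrimes_of_le`, class through `E[3^m·3]`, `k ≤ m`),
hence usable primes of Kato's system for `(c, d, A, N)` (`hcdA`, `hN`); `𝓕_can,3 = ⊤` at every depth
from `ht0` (Mazur–Rubin Lemma A.1 along `exists_torsionReduction_three`,
`propagatedSelmerStructure_three_eq_top_of_torsion_eq_zero`); `η` generates at the class primes
(`HasCanonicalComparison.zpowers_eq_top`).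

## Reading for the route (labelled)

* This is Büyükboduk 2009 Thm. 3.1 / Cor. 3.3 («`κ^{Kato} ∈ 3^{m+1} KS`» when `3^{m+1} ∣ c_ℓ`) READ ON KIM'S
  KURIHARA NUMBERS at `p = 3`, every reduction type at `3` and at `ℓ`, GRANTED (a)–(f).
* With `m + 1 = v₃(c_ℓ)` (§2) it is the (TD) binder `hTD` of crux 19679's corner road
  (`KimAtThreeDeepLowerOffStratumCornerKeysSharp.stub_nonAdditive_…_of_tamagawa_le_deepInfty`,
  `(v₃ ∏ c_ℓ : ℕ∞) ≤ ∂^{(∞)}_{deep}`) on the rows with ONE Tamagawa-`3` prime; on rows with two or more the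
  product exponent is NOT obtainable from Kolyvagin systems for `𝓕_u` (part XVII) — Kim 2025 Conj. 7.1.
* No port is introduced: the displayed inputs are ★ PK-6₂'s (the dischargers of the route's ONE debt class
  PORT″/PORT@3-OFF) and part XV's standing binders.

References: K. Büyükboduk, JNT 129 (2009) Thm. 3.1, Cor. 3.3, §4.2; K. Kato, Astérisque 295 (2004) (8.1.3),
§9.4, Thm. 9.7, Ex. 13.3; C.-H. Kim, AJM 148 (2026) §1.2.2, §1.5.1, Thm. 3.13, Conj. 1.10; B. Mazur,
K. Rubin, Mem. AMS 799 (2004) Thm. 3.2.4, Thm. 5.2.12 (i), Prop. 6.2.6, App. A (33), Lemma A.1, Remark A.5;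
R. Sakamoto, JTNB 36 (2024) §2, Def. 4.1.
-/

noncomputable section

-- the cell's Theorems namespace `Summit.BirchSwinnertonDyer.BirchSwinnertonDyer.…` repeats the summit name by design (D-0017)
set_option linter.dupNamespace false

open scoped NumberField TensorProduct ContRepresentation Classical
open CategoryTheory Field Function Finset IsDedekindDomain NumberField WeierstrassCurve
open Rat.HeightOneSpectrum
open Literature.NumberTheory.GaloisRepresentations Literature.NumberTheory.GaloisCohomology
open Literature.NumberTheory.GaloisRepresentations.DiscreteGaloisModule
open Literature.NumberTheory.EllipticCurves Literature.NumberTheory.EllipticCurves.ModularForms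
open Literature.NumberTheory.EllipticCurves.Kato2004
open Literature.NumberTheory.EllipticCurves.Kato2004.EulerSystemValues
open Summit.BirchSwinnertonDyer.Rank1Residual.GaloisImage
open Summit.BirchSwinnertonDyer.BirchSwinnertonDyer.Theorems.KimAtThreeD7uTamagawaKuriharaDeepLe
open Summit.BirchSwinnertonDyer.BirchSwinnertonDyer.Theorems.KimAtThreeD7uTamagawaKuriharaWitness

namespace Summit.BirchSwinnertonDyer.BirchSwinnertonDyer.Theorems.KimAtThreeD7uTamagawaKuriharaEnd

variable (W : WeierstrassCurve ℚ) [W.IsElliptic] [W.IsGloballyMinimal]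
  [ContinuousSMul ℤ_[3] (W.tateModule 3)] [Module.Free ℤ_[3] (W.tateModule 3)]
  [Module.Finite ℤ_[3] (W.tateModule 3)]

/-- Local notation: `𝐃F⟦r, τ⟧ ℓ = Σ_{j<ℓ−1} j·σ_{χ_{m(0,r)}(τ_ℓ)}^j` on the level field `ℚ(ζ_{m(0,r)})`
(n1011 PK-1 ★2's field-side spelling, `p = 3`). -/
local notation3 (prettyPrint := false) "𝐃F⟦" r ", " τ "⟧" =>
  fun ℓ : HeightOneSpectrum (𝓞 ℚ) =>
  ∑ j ∈ Finset.range (((primesEquiv ℓ : Nat.Primes) : ℕ) - 1),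
    (j : Module.End ℚ (CyclotomicField (cycLevel 3 0 r) ℚ)) *
      (sigma (cycLevel 3 0 r) (modNCyclotomicCharacter ℚ (cycLevel 3 0 r)
          ((τ : HeightOneSpectrum (𝓞 ℚ) → absoluteGaloisGroup ℚ) ℓ)) :
        CyclotomicField (cycLevel 3 0 r) ℚ →ₐ[ℚ] CyclotomicField (cycLevel 3 0 r) ℚ).toLinearMap ^ j

set_option backward.isDefEq.respectTransparency false in
/-- **★★★ «TamDiv∞» in Kurihara currency FROM KATO'S EULER SYSTEM — the END** (module docstring): for
`W/ℚ` with the `3`-adic tower onto and `3^{m+1} ∣ c_ℓ` at one finite `ℓ ∤ 3`, GRANTED ★ PK-6₂'s displayed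
inputs (a)–(d) (minus `hbad`), part XV's binders (e) and the tower:
**`(m + 1 : ℕ∞) ≤ kuriharaPartialDeepInfty W 3 P₀.f`**.
[cite: Buyukboduk2009TamagawaDefect, Thm. 3.1 and Cor. 3.3] [cite: Kato2004Asterisque, (8.1.3) (p. 180), §9.4 (p. 188) and Thm. 9.7 (p. 189)]
[cite: Kim2022StructureSelmer, §1.2.2, Thm. 3.13 and Conj. 1.10 (PDF p. 8)]
[cite: MazurRubin2004, Thm. 3.2.4, Thm. 5.2.12 (i), Prop. 6.2.6 and App. A (Lemma A.1, Remark A.5)]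
[cite: Sakamoto2024, §2 (pp. 920–921) and Def. 4.1] -/
theorem natCast_le_kuriharaPartialDeepInfty_of_zetaBody_of_pow_succ_dvd
    [Finite (geomTorsion W ((3 : ℕ) : ℤ))] [Finite (geomTorsion W (((3 : ℕ) : ℤ) ^ 0 * ((3 : ℕ) : ℤ)))]
    (htower : ∀ n : ℕ, W.HasSurjectiveModNGaloisRep (3 ^ n : ℕ))
    -- (e) part XV's binders, data pinned on the class of `τ` through `E[3^m·3]` off `{bad} ∪ {3}`
    {inv : LocalInvariants ℚ 3}
    (hperf : inv.IsPerfect) (hsum : inv.SumLocalTermEqZero) (hcompl : inv.SelmerComplement)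
    (hEP : ∀ v : HeightOneSpectrum (𝓞 ℚ), localEulerPoincareCharacteristic (v.adicCompletion ℚ))
    (T : Finset (HeightOneSpectrum (𝓞 ℚ)))
    (h3T : ∀ v : HeightOneSpectrum (𝓞 ℚ), ((3 : ℕ) : 𝓞 ℚ) ∈ v.asIdeal → v ∈ T)
    (hbadT : ∀ v : HeightOneSpectrum (𝓞 ℚ), ¬ W.HasGoodReductionAt v → v ∈ T)
    -- (g) ONE Tamagawa number divisible by `3^{m+1}`
    {ℓ : HeightOneSpectrum (𝓞 ℚ)} (h3ℓ : ((3 : ℕ) : 𝓞 ℚ) ∉ ℓ.asIdeal) (m : ℕ)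
    (hm : 3 ^ (m + 1) ∣ (W.baseChange (ℓ.adicCompletion ℚ)).localTamagawaNumber (ℓ.adicCompletionIntegers ℚ))
    (h0 : ∀ (j : ℕ) (Q : geomTorsion W (((3 : ℕ) : ℤ) ^ j * ((3 : ℕ) : ℤ))),
      (∀ σ : absoluteGaloisGroup ℚ,
        W.torsionGaloisModule (((3 : ℕ) : ℤ) ^ j * ((3 : ℕ) : ℤ)) σ Q = Q) → Q = 0)
    {Sset : Set (HeightOneSpectrum (𝓞 ℚ))}
    (hSset : ∀ v, v ∈ Sset ↔ (¬ W.HasGoodReductionAt v ∨ ((3 : ℕ) : 𝓞 ℚ) ∈ v.asIdeal))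
    {τ : absoluteGaloisGroup ℚ}
    (hτ : ∀ j : ℕ, Nonempty (cokerSubOne (W.torsionGaloisModule (((3 : ℕ) : ℤ) ^ j * ((3 : ℕ) : ℤ))) τ ≃+
      ZMod (3 ^ (j + 1))))
    (hτ₁ : Nonempty (cokerSubOne (W.torsionGaloisModule ((3 : ℕ) : ℤ)) τ ≃+ ZMod 3))
    (hτμ : τ ∈ rootsOfUnityFixer ℚ (3 ^ (m + 1)))
    (D : (j : ℕ) → KolyvaginDatum (W.torsionGaloisModule (((3 : ℕ) : ℤ) ^ j * ((3 : ℕ) : ℤ))))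
    (hP : ∀ j, (D j).primes = frobeniusClassPrimes
      (W.torsionGaloisModule (((3 : ℕ) : ℤ) ^ m * ((3 : ℕ) : ℤ))) Sset τ (3 ^ (m + 1)))
    (hPT : ∀ q ∈ frobeniusClassPrimes
      (W.torsionGaloisModule (((3 : ℕ) : ℤ) ^ m * ((3 : ℕ) : ℤ))) Sset τ (3 ^ (m + 1)), q ∉ T)
    (hT : ∀ j, (D j).transverse = cyclotomicTransverse _)
    {η : (q : HeightOneSpectrum (𝓞 ℚ)) → (ZMod (Ideal.absNorm q.asIdeal))ˣ}
    (hD : ∀ j, j ≤ m → (D j).HasCanonicalComparison (3 ^ (j + 1)) η) (hadm : ∀ j, j ≤ m → (D j).IsAdmissible)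
    (hprime : ∀ c : galoisCohomology (W.torsionGaloisModule (((3 : ℕ) : ℤ) ^ 0 * ((3 : ℕ) : ℤ))) 1, c ≠ 0 →
      ∀ c' : galoisCohomology (DiscreteGaloisModule.tateDual
        (W.torsionGaloisModule (((3 : ℕ) : ℤ) ^ 0 * ((3 : ℕ) : ℤ))) 3) 1, c' ≠ 0 →
      {q ∈ (D 0).primes |
        galoisCohomology.localization (W.torsionGaloisModule (((3 : ℕ) : ℤ) ^ 0 * ((3 : ℕ) : ℤ)))
          (Sum.inr q) 1 c ≠ 0 ∧
        galoisCohomology.localization (DiscreteGaloisModule.tateDual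
          (W.torsionGaloisModule (((3 : ℕ) : ℤ) ^ 0 * ((3 : ℕ) : ℤ))) 3) (Sum.inr q) 1 c' ≠ 0}.Infinite)
    -- (a) Kato's `ZetaBody` for `P₀.f` at the conductor level
    {N : ℕ} [NeZero N] (P₀ : ModularParametrizationData W N) (hN : N = W.conductorNorm ℤ)
    {ι : (n : ℕ) → (CyclotomicField n ℚ →+* ℂ)} {κK : ℝ}
    {Λ : ∀ (k' : ℕ) (r : Finset (HeightOneSpectrum (𝓞 ℚ))),
      H1 (tateRep W 3) (cycSubgroup 3 k' r) →ₗ[ℤ_[3]] ℚ_[3] ⊗[ℚ] CyclotomicField (cycLevel 3 k' r) ℚ}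
    {c d a : ℤ} {A : ℕ}
    {z : ∀ (k' : ℕ) (r : (cyclotomicLevelsRat 3 (badPlaces c d A N)).Ideals),
      H1 (tateRep W 3) ((cyclotomicLevelsRat 3 (badPlaces c d A N)).level k' r.1)}
    {x : ∀ (k' : ℕ) (r : (cyclotomicLevelsRat 3 (badPlaces c d A N)).Ideals),
      CyclotomicField (cycLevel 3 k' r.1) ℚ}
    (hbody : ZetaBody W 3 P₀.f ι κK Λ c d a A z x)
    -- (b) the (P-EXP) riders at every depth, `t = 0`
    {v₃ : HeightOneSpectrum (𝓞 ℚ)} (hv₃ : ((3 : ℕ) : 𝓞 ℚ) ∈ v₃.asIdeal)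
    (Λfin : ∀ j : ℕ, galoisCohomology ((W.torsionGaloisModule (((3 : ℕ) : ℤ) ^ j * ((3 : ℕ) : ℤ))).toLocal
      (Sum.inr v₃)) 1 →+ ZMod (3 ^ (j + 1)))
    (hfin : ∀ j : ℕ, KatoExpStarFiniteLevelAt W 3 j 0 v₃ Λ (Λfin j))
    -- (c) the auxiliary datum avoids every prime `≡ 1 (mod 3)`; `t = 0`
    (hcdA : ∀ q : ℕ, q.Prime → q ≡ 1 [MOD 3] → ¬ q ∣ 2 * c.natAbs * d.natAbs * A)
    (ht0 : ∀ w : HeightOneSpectrum (𝓞 ℚ), ((3 : ℕ) : 𝓞 ℚ) ∈ w.asIdeal →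
        ∀ Q : (W.baseChange (w.adicCompletion ℚ)).toAffine.Point, 3 • Q = 0 → Q = 0)
    -- (d) the per-level VALUE ROWS (T-PK6-VROW's OUT), displayed
    (hvalue : ∀ (j : ℕ) (σ : HeightOneSpectrum (𝓞 ℚ) → absoluteGaloisGroup ℚ),
      (∀ q, σ q ∈ (adicCompletionPrime ℚ q).inertia (absoluteGaloisGroup ℚ)) →
      (∀ q, modNCyclotomicCharacter ℚ (Ideal.absNorm q.asIdeal) (σ q) = η q) →
      ∀ (r : Finset (HeightOneSpectrum (𝓞 ℚ)))
        (hr : ∀ q ∈ r, q ∈ (cyclotomicLevelsRat 3 (badPlaces c d A N)).primes),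
        (∀ q ∈ r, Kato.IsKolyvaginPrime W 3 (j + 1) ((primesEquiv q : Nat.Primes) : ℕ)) →
        (∀ q ∈ r, Subgroup.zpowers (η q) = ⊤) →
        ∃ (s : ℤ_[3]) (u : (ZMod (3 ^ (j + 1)))ˣ)
          (ψ : (ℓ : ℕ) → (ZMod ℓ)ˣ →* Multiplicative (ZMod (3 ^ (j + 1)))),
          (∀ q ∈ r, Function.Surjective (ψ (Ideal.absNorm q.asIdeal))) ∧
          (∃ l ∈ cycIntLattice 3 (cycLevel 3 0 r),
            (((3 : ℕ) : ℤ_[3]) ^ (0 : ℕ)) • ((1 : ℚ_[3]) ⊗ₜ[ℚ]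
              ((r.noncommProd 𝐃F⟦r, σ⟧ (ZetaValue.pairwise_commute_fieldDeriv (cycLevel 3 0 r)
                  (fun ℓ => modNCyclotomicCharacter ℚ (cycLevel 3 0 r) (σ ℓ))
                  (fun ℓ => ((primesEquiv ℓ : Nat.Primes) : ℕ) - 1) r))
                (x 0 ⟨r, hr⟩ + sigma (cycLevel 3 0 r) (-1) (x 0 ⟨r, hr⟩)))) -
              ((s : ℚ_[3]) ⊗ₜ[ℚ] (1 : CyclotomicField (cycLevel 3 0 r) ℚ)) =
            (((3 : ℕ) : ℤ_[3]) ^ (j + 1)) • (l : ℚ_[3] ⊗[ℚ] CyclotomicField (cycLevel 3 0 r) ℚ)) ∧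
          haveI : NeZero (∏ q ∈ r, Ideal.absNorm q.asIdeal) :=
            ⟨Finset.prod_ne_zero_iff.2 fun q _ h => q.ne_bot (Ideal.absNorm_eq_zero_iff.1 h)⟩
          PadicInt.toZModPow (j + 1) s = (u : ZMod (3 ^ (j + 1))) *
            ((3 : ℕ) : ZMod (3 ^ (j + 1))) ^ (0 : ℕ) *
              kuriharaNumber P₀.f (3 ^ (j + 1)) (∏ q ∈ r, Ideal.absNorm q.asIdeal) ψ) :
    ((m + 1 : ℕ) : ℕ∞) ≤ kuriharaPartialDeepInfty W 3 P₀.f := by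
  haveI : Fact (Nat.Prime 3) := ⟨Nat.prime_three⟩
  have hirr : W.HasIrreducibleModPGaloisRep 3 :=
    hasIrreducibleModPGaloisRep_of_hasSurjectiveModNGaloisRep W 3 (by simpa using htower 1)
  have hSgood : ∀ v ∉ Sset, W.HasGoodReductionAt v := fun v hv => by
    by_contra h
    exact hv ((hSset v).2 (Or.inl h))
  -- the class primes are Kolyvagin of level `k + 1` for every `k ≤ m` (E1-deep on the pinned class)
  have hKol : ∀ k, k ≤ m → ∀ q ∈ (D k).primes,
      Kato.IsKolyvaginPrime W 3 (k + 1) ((primesEquiv q : Nat.Primes) : ℕ) := by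
    intro k hk q hq
    rw [hP k] at hq
    exact KolyvaginPrime.isKolyvaginPrime_of_mem_frobeniusClassPrimes_of_le W hk hSgood hτμ (hτ m) hq
  -- … hence usable primes of Kato's system for `(c, d, A, N)`
  have husable : ∀ (j : ℕ) (q : HeightOneSpectrum (𝓞 ℚ)),
      Kato.IsKolyvaginPrime W 3 (j + 1) ((primesEquiv q : Nat.Primes) : ℕ) →
        q ∈ (cyclotomicLevelsRat 3 (badPlaces c d A N)).primes := by
    intro j q hq
    have hℓ := hq.prime
    have h13 : ((primesEquiv q : Nat.Primes) : ℕ) ≡ 1 [MOD 3] :=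
      hq.modEq_one.of_dvd (dvd_pow_self 3 (Nat.succ_ne_zero j))
    refine (mem_primes_cyclotomicLevelsRat_badPlaces_iff 3 c d A N q).2 ⟨fun hdvd => ?_, hq.ne⟩
    rcases (Nat.Prime.dvd_mul hℓ).mp hdvd with h | h
    · exact hcdA _ hℓ h13 h
    · apply hq.not_dvd
      rw [← hN]
      exact dvd_mul_of_dvd_left h 3
  have hPr : ∀ k, k ≤ m → (D k).primes ⊆ (cyclotomicLevelsRat 3 (badPlaces c d A N)).primes :=
    fun k hk q hq => husable k q (hKol k hk q hq)
  -- `𝓕_can,3 = ⊤` at every depth (`t = 0`, Mazur–Rubin Lemma A.1 along the reduction tower)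
  have htw : ∀ j : ℕ,
      ∃ redj : (W.torsionGaloisModule (((3 : ℕ) : ℤ) ^ (j + 1) * ((3 : ℕ) : ℤ))).toContRepresentation →ⁱL
          (W.torsionGaloisModule (((3 : ℕ) : ℤ) ^ j * ((3 : ℕ) : ℤ))).toContRepresentation,
        ∀ y : geomTorsion W (((3 : ℕ) : ℤ) ^ (j + 1) * ((3 : ℕ) : ℤ)),
          ((redj y : geomTorsion W (((3 : ℕ) : ℤ) ^ j * ((3 : ℕ) : ℤ))) : geomPoints W) =
            ((3 : ℕ) : ℤ) • (y : geomPoints W) := by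
    intro j
    obtain ⟨redj, hredj⟩ := exists_torsionReduction_three W j (j + 1)
    refine ⟨redj, fun y => ?_⟩
    rw [hredj, Nat.add_sub_cancel_left, pow_one]
  choose redT hredT using htw
  have htop : ∀ (j : ℕ) (w : HeightOneSpectrum (𝓞 ℚ)), ((primesEquiv w : Nat.Primes) : ℕ) = 3 →
      propagatedSelmerStructure W 3 j (Sum.inr w) = ⊤ := by
    intro j w hw
    have hw3 : ((3 : ℕ) : 𝓞 ℚ) ∈ w.asIdeal := KolyvaginPrime.natCast_mem_asIdeal_of_primesEquiv_eq hw
    exact propagatedSelmerStructure_three_eq_top_of_torsion_eq_zero W w hw3 (ht0 w hw3) redT hredT j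
  -- part XXIII with the witnesses of part XXIV
  refine natCast_le_kuriharaPartialDeepInfty_of_witnesses_of_pow_succ_dvd_le W htower hperf hsum hcompl hEP T
    h3T hbadT h3ℓ m hm h0 (fun v hv => (hSset v).1 hv) hτ hτ₁ hτμ D hP hPT hT hD hadm hprime (v₃ := v₃) P₀
    fun k hk => ?_
  obtain ⟨κ, hW, hκ⟩ := exists_katoKuriharaWitnessAt_blochKato_of_zetaBody W P₀ hbody hirr k hv₃ (hfin k)
    (D k) (hT k) (hD k hk) (hPr k hk) (hKol k hk) (htop k)
    (fun σ hI hχ r hr => hvalue k σ hI hχ r (fun q hq => hPr k hk (hr (Finset.mem_coe.2 hq)))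
      (fun q hq => hKol k hk q (hr (Finset.mem_coe.2 hq)))
      (fun q hq => (hD k hk).zpowers_eq_top (hr (Finset.mem_coe.2 hq))))
  exact ⟨κ, Λfin k, κ, hW, hκ⟩

/-- **The same with the exponent read as `v₃(c_ℓ)`**: `(v₃(c_ℓ) : ℕ∞) ≤ ∂^{(∞)}_{deep}(δ̃)` for
`v₃(c_ℓ) = m + 1` — the (TD) binder of crux 19679's corner road on the rows with ONE Tamagawa-`3` prime,
FROM KATO'S EULER SYSTEM granted (a)–(f). [cite: Buyukboduk2009TamagawaDefect, Thm. 3.1, Cor. 3.3 and §4.2 (Question 1)]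
[cite: Kim2022StructureSelmer, Conj. 1.10 (PDF p. 8)] [cite: MazurRubin2004, App. A Remark A.5] -/
theorem natCast_padicValNat_le_kuriharaPartialDeepInfty_of_zetaBody
    [Finite (geomTorsion W ((3 : ℕ) : ℤ))] [Finite (geomTorsion W (((3 : ℕ) : ℤ) ^ 0 * ((3 : ℕ) : ℤ)))]
    (htower : ∀ n : ℕ, W.HasSurjectiveModNGaloisRep (3 ^ n : ℕ))
    {inv : LocalInvariants ℚ 3}
    (hperf : inv.IsPerfect) (hsum : inv.SumLocalTermEqZero) (hcompl : inv.SelmerComplement)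
    (hEP : ∀ v : HeightOneSpectrum (𝓞 ℚ), localEulerPoincareCharacteristic (v.adicCompletion ℚ))
    (T : Finset (HeightOneSpectrum (𝓞 ℚ)))
    (h3T : ∀ v : HeightOneSpectrum (𝓞 ℚ), ((3 : ℕ) : 𝓞 ℚ) ∈ v.asIdeal → v ∈ T)
    (hbadT : ∀ v : HeightOneSpectrum (𝓞 ℚ), ¬ W.HasGoodReductionAt v → v ∈ T)
    {ℓ : HeightOneSpectrum (𝓞 ℚ)} (h3ℓ : ((3 : ℕ) : 𝓞 ℚ) ∉ ℓ.asIdeal) (m : ℕ)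
    (hmv : padicValNat 3 ((W.baseChange (ℓ.adicCompletion ℚ)).localTamagawaNumber
      (ℓ.adicCompletionIntegers ℚ)) = m + 1)
    (h0 : ∀ (j : ℕ) (Q : geomTorsion W (((3 : ℕ) : ℤ) ^ j * ((3 : ℕ) : ℤ))),
      (∀ σ : absoluteGaloisGroup ℚ,
        W.torsionGaloisModule (((3 : ℕ) : ℤ) ^ j * ((3 : ℕ) : ℤ)) σ Q = Q) → Q = 0)
    {Sset : Set (HeightOneSpectrum (𝓞 ℚ))}
    (hSset : ∀ v, v ∈ Sset ↔ (¬ W.HasGoodReductionAt v ∨ ((3 : ℕ) : 𝓞 ℚ) ∈ v.asIdeal))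
    {τ : absoluteGaloisGroup ℚ}
    (hτ : ∀ j : ℕ, Nonempty (cokerSubOne (W.torsionGaloisModule (((3 : ℕ) : ℤ) ^ j * ((3 : ℕ) : ℤ))) τ ≃+
      ZMod (3 ^ (j + 1))))
    (hτ₁ : Nonempty (cokerSubOne (W.torsionGaloisModule ((3 : ℕ) : ℤ)) τ ≃+ ZMod 3))
    (hτμ : τ ∈ rootsOfUnityFixer ℚ (3 ^ (m + 1)))
    (D : (j : ℕ) → KolyvaginDatum (W.torsionGaloisModule (((3 : ℕ) : ℤ) ^ j * ((3 : ℕ) : ℤ))))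
    (hP : ∀ j, (D j).primes = frobeniusClassPrimes
      (W.torsionGaloisModule (((3 : ℕ) : ℤ) ^ m * ((3 : ℕ) : ℤ))) Sset τ (3 ^ (m + 1)))
    (hPT : ∀ q ∈ frobeniusClassPrimes
      (W.torsionGaloisModule (((3 : ℕ) : ℤ) ^ m * ((3 : ℕ) : ℤ))) Sset τ (3 ^ (m + 1)), q ∉ T)
    (hT : ∀ j, (D j).transverse = cyclotomicTransverse _)
    {η : (q : HeightOneSpectrum (𝓞 ℚ)) → (ZMod (Ideal.absNorm q.asIdeal))ˣ}
    (hD : ∀ j, j ≤ m → (D j).HasCanonicalComparison (3 ^ (j + 1)) η) (hadm : ∀ j, j ≤ m → (D j).IsAdmissible)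
    (hprime : ∀ c : galoisCohomology (W.torsionGaloisModule (((3 : ℕ) : ℤ) ^ 0 * ((3 : ℕ) : ℤ))) 1, c ≠ 0 →
      ∀ c' : galoisCohomology (DiscreteGaloisModule.tateDual
        (W.torsionGaloisModule (((3 : ℕ) : ℤ) ^ 0 * ((3 : ℕ) : ℤ))) 3) 1, c' ≠ 0 →
      {q ∈ (D 0).primes |
        galoisCohomology.localization (W.torsionGaloisModule (((3 : ℕ) : ℤ) ^ 0 * ((3 : ℕ) : ℤ)))
          (Sum.inr q) 1 c ≠ 0 ∧
        galoisCohomology.localization (DiscreteGaloisModule.tateDual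
          (W.torsionGaloisModule (((3 : ℕ) : ℤ) ^ 0 * ((3 : ℕ) : ℤ))) 3) (Sum.inr q) 1 c' ≠ 0}.Infinite)
    {N : ℕ} [NeZero N] (P₀ : ModularParametrizationData W N) (hN : N = W.conductorNorm ℤ)
    {ι : (n : ℕ) → (CyclotomicField n ℚ →+* ℂ)} {κK : ℝ}
    {Λ : ∀ (k' : ℕ) (r : Finset (HeightOneSpectrum (𝓞 ℚ))),
      H1 (tateRep W 3) (cycSubgroup 3 k' r) →ₗ[ℤ_[3]] ℚ_[3] ⊗[ℚ] CyclotomicField (cycLevel 3 k' r) ℚ}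
    {c d a : ℤ} {A : ℕ}
    {z : ∀ (k' : ℕ) (r : (cyclotomicLevelsRat 3 (badPlaces c d A N)).Ideals),
      H1 (tateRep W 3) ((cyclotomicLevelsRat 3 (badPlaces c d A N)).level k' r.1)}
    {x : ∀ (k' : ℕ) (r : (cyclotomicLevelsRat 3 (badPlaces c d A N)).Ideals),
      CyclotomicField (cycLevel 3 k' r.1) ℚ}
    (hbody : ZetaBody W 3 P₀.f ι κK Λ c d a A z x)
    {v₃ : HeightOneSpectrum (𝓞 ℚ)} (hv₃ : ((3 : ℕ) : 𝓞 ℚ) ∈ v₃.asIdeal)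
    (Λfin : ∀ j : ℕ, galoisCohomology ((W.torsionGaloisModule (((3 : ℕ) : ℤ) ^ j * ((3 : ℕ) : ℤ))).toLocal
      (Sum.inr v₃)) 1 →+ ZMod (3 ^ (j + 1)))
    (hfin : ∀ j : ℕ, KatoExpStarFiniteLevelAt W 3 j 0 v₃ Λ (Λfin j))
    (hcdA : ∀ q : ℕ, q.Prime → q ≡ 1 [MOD 3] → ¬ q ∣ 2 * c.natAbs * d.natAbs * A)
    (ht0 : ∀ w : HeightOneSpectrum (𝓞 ℚ), ((3 : ℕ) : 𝓞 ℚ) ∈ w.asIdeal →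
        ∀ Q : (W.baseChange (w.adicCompletion ℚ)).toAffine.Point, 3 • Q = 0 → Q = 0)
    (hvalue : ∀ (j : ℕ) (σ : HeightOneSpectrum (𝓞 ℚ) → absoluteGaloisGroup ℚ),
      (∀ q, σ q ∈ (adicCompletionPrime ℚ q).inertia (absoluteGaloisGroup ℚ)) →
      (∀ q, modNCyclotomicCharacter ℚ (Ideal.absNorm q.asIdeal) (σ q) = η q) →
      ∀ (r : Finset (HeightOneSpectrum (𝓞 ℚ)))
        (hr : ∀ q ∈ r, q ∈ (cyclotomicLevelsRat 3 (badPlaces c d A N)).primes),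
        (∀ q ∈ r, Kato.IsKolyvaginPrime W 3 (j + 1) ((primesEquiv q : Nat.Primes) : ℕ)) →
        (∀ q ∈ r, Subgroup.zpowers (η q) = ⊤) →
        ∃ (s : ℤ_[3]) (u : (ZMod (3 ^ (j + 1)))ˣ)
          (ψ : (ℓ : ℕ) → (ZMod ℓ)ˣ →* Multiplicative (ZMod (3 ^ (j + 1)))),
          (∀ q ∈ r, Function.Surjective (ψ (Ideal.absNorm q.asIdeal))) ∧
          (∃ l ∈ cycIntLattice 3 (cycLevel 3 0 r),
            (((3 : ℕ) : ℤ_[3]) ^ (0 : ℕ)) • ((1 : ℚ_[3]) ⊗ₜ[ℚ]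
              ((r.noncommProd 𝐃F⟦r, σ⟧ (ZetaValue.pairwise_commute_fieldDeriv (cycLevel 3 0 r)
                  (fun ℓ => modNCyclotomicCharacter ℚ (cycLevel 3 0 r) (σ ℓ))
                  (fun ℓ => ((primesEquiv ℓ : Nat.Primes) : ℕ) - 1) r))
                (x 0 ⟨r, hr⟩ + sigma (cycLevel 3 0 r) (-1) (x 0 ⟨r, hr⟩)))) -
              ((s : ℚ_[3]) ⊗ₜ[ℚ] (1 : CyclotomicField (cycLevel 3 0 r) ℚ)) =
            (((3 : ℕ) : ℤ_[3]) ^ (j + 1)) • (l : ℚ_[3] ⊗[ℚ] CyclotomicField (cycLevel 3 0 r) ℚ)) ∧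
          haveI : NeZero (∏ q ∈ r, Ideal.absNorm q.asIdeal) :=
            ⟨Finset.prod_ne_zero_iff.2 fun q _ h => q.ne_bot (Ideal.absNorm_eq_zero_iff.1 h)⟩
          PadicInt.toZModPow (j + 1) s = (u : ZMod (3 ^ (j + 1))) *
            ((3 : ℕ) : ZMod (3 ^ (j + 1))) ^ (0 : ℕ) *
              kuriharaNumber P₀.f (3 ^ (j + 1)) (∏ q ∈ r, Ideal.absNorm q.asIdeal) ψ) :
    ((padicValNat 3 ((W.baseChange (ℓ.adicCompletion ℚ)).localTamagawaNumber
        (ℓ.adicCompletionIntegers ℚ)) : ℕ) : ℕ∞) ≤ kuriharaPartialDeepInfty W 3 P₀.f := by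
  have hdvd : 3 ^ (m + 1) ∣ (W.baseChange (ℓ.adicCompletion ℚ)).localTamagawaNumber
      (ℓ.adicCompletionIntegers ℚ) := hmv ▸ pow_padicValNat_dvd
  rw [hmv]
  exact natCast_le_kuriharaPartialDeepInfty_of_zetaBody_of_pow_succ_dvd W htower hperf hsum hcompl hEP T h3T
    hbadT h3ℓ m hdvd h0 hSset hτ hτ₁ hτμ D hP hPT hT hD hadm hprime P₀ hN hbody hv₃ Λfin hfin hcdA ht0 hvalue

end Summit.BirchSwinnertonDyer.BirchSwinnertonDyer.Theorems.KimAtThreeD7uTamagawaKuriharaEnd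

end
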